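import Summits.Ventures.QEC.Census.AdditiveCertChunks
import Summits.Ventures.QEC.Census.CertBZPlaneSound
import HarnessLib

/-!
# General-stabilizer (`AddCert`) certificates, IV: the LANE-PARALLEL replay (bit-sliced Pauli enumeration)

`AddCert.check` (`Census/AdditiveCertCheck.lean`, qec-type-02) replays the brute force over all Pauli words of weight
`≤ d − 1` one word at a time (`scan4`; ≈ 10²–10³ words/s in the kernel); `Census/AdditiveCertChunks.lean` splits it into
`3n` chunks. This file evaluates the SAME brute force with qec-type-01's lane engine (`Census/CertBZPlane*.lean`): every
kernel step acts on a whole LANE FAMILY of selections at once (one `Nat` per indicator word / plane, GMP in the kernel).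

* The `3n` LETTER ROWS of a certificate `c` (qubit `j`: `X_j`, `Z_j`, `Y_j`) are encoded as words
  `enc w = syndrome bits of w ‖ x-mask ‖ z-mask` (`r = |rows|` syndrome columns, then `n + n` mask bits); a selection
  of letter rows XORs to `enc` of the product of its letters (`enc` is additive), so type-01's `segment t m₀ s` families
  (all selections of `1 … t` rows with largest row in `[m₀, m₀+s)`) enumerate — with harmless over-enumeration — every
  Pauli word of weight `≤ t`; the selections with two letters on one qubit are masked out (`validMask`).
* Per family: the syndrome planes (columns `0 … r−1`) feed the threshold counter with `θ = 1`; the valid lanes with ALL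
  syndromes zero («stragglers») are decoded one by one and must be the identity or an allow-listed stabilizer
  (type-01's `failLoop`/`bzLeaf` on the encoded word; `allowWords`).
* `AddCert.laneCheck c m₀ s fuel : Bool` is one family; `AddCert.checkStructureL` = type-02's `checkStructure` + bounds on
  the allow-list words. This file: the DEFINITIONS, the bit layout / additivity / injectivity of `enc`, and the letter
  rows (`xorList_letterRows`: the letter rows of a lettered selection XOR to the encoding of its word).
  SOUNDNESS is in the sequels `Census/AdditiveCertLanesCover.lean` (every low-weight Pauli word is a valid lane;
  `Reaches4 (leaf n rows allowList) (range n) (d−1) 0 0` — the SAME proposition type-02's chunked replay establishes) and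
  `Census/AdditiveCertLanesSound.lean` (`IsAdditiveCode c.code c.k c.d`, `minDistance c.code = c.d`, purity,
  `AdditiveCodeExists` / `PureAdditiveCodeExists` — the `…_of_lanes` theorems, with the use pattern for census files).
MEASURED (farm, `decide +kernel`, standard axioms, qec-search-5 g2, 2026-08-27): the `[[14,0,6]]` calibration certificate
(`certStabN14K0`, 578 256 Pauli words = 975 981 lanes in ONE family) in ≈ 2 s, against one `native_decide` before.
Standard axioms; no `native_decide`.
-/

set_option autoImplicit false

namespace Summit.Ventures.QEC.Census

open Literature.InformationTheory.QuantumCodes Plane List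

/-! ## Definitions -/

/-- The syndrome word of a packed Pauli word `w` against `rows`: bit `i` = symplectic parity with `rows[i]`.
(definition) -/
def synWord (n : ℕ) : List (ℕ × ℕ) → ℕ × ℕ → ℕ
  | [], _ => 0
  | r :: rs, w => sympParity n r w ||| (synWord n rs w <<< 1)

/-- Lane-validity mask of an indicator list read in TRIPLES (the three letter rows of one qubit): a lane is valid iff
no triple has two of its rows selected. (definition) -/
def validMask (N : ℕ) : List ℕ → ℕ
  | a :: b :: e :: rest => (ones N ^^^ ((a &&& b) ||| (a &&& e) ||| (b &&& e))) &&& validMask N rest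
  | _ => ones N

/-- **One lane family, with validity mask** (cf. type-01's `familyOK`): count the columns `cols` of every lane's word
against the threshold `θ`, then re-check with `bzLeaf` the VALID lanes below threshold (`fuel` stragglers tolerated).
(definition) -/
def familyOKv (wmax : ℕ) (cols allow G : List ℕ) (fam : ℕ × List ℕ) (θ fuel : ℕ) : Bool :=
  failLoop wmax allow G fam.2 fuel
    (validMask fam.1 fam.2 &&& (ones fam.1 ^^^ lastD (countCols G fam.2 cols (List.replicate θ 0)) 0))

namespace AddCert

variable (c : AddCert)

/-- The lane word of a packed Pauli word `w = (x, z)`: `r = |rows|` syndrome bits, then `x` shifted by `r`, then `z`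
shifted by `r + n`. (definition) -/
def enc (w : ℕ × ℕ) : ℕ := synWord c.n c.rows w ||| (w.1 <<< c.rows.length) ||| (w.2 <<< (c.rows.length + c.n))

/-- The letter rows of qubits `j, j+1, …, j+m−1`, three per qubit in the order `X, Z, Y`. (definition) -/
def letterRowsFrom : ℕ → ℕ → List ℕ
  | _, 0 => []
  | j, m + 1 => c.enc (2 ^ j, 0) :: c.enc (0, 2 ^ j) :: c.enc (2 ^ j, 2 ^ j) :: letterRowsFrom (j + 1) m

/-- The `3n` letter rows (row `3j` = `X_j`, `3j+1` = `Z_j`, `3j+2` = `Y_j`). (definition) -/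
def letterRows : List ℕ := c.letterRowsFrom 0 c.n

/-- The allowed straggler words: the identity (`0`) and the encoded allow-list of the certificate. (definition) -/
def allowWords : List ℕ := 0 :: c.allowList.map c.enc

/-- **One segment of the lane replay**: the family of all selections of `1 … d−1` letter rows whose largest row lies in
`[m₀, m₀+s)`; syndrome columns `0 … r−1`, threshold `1`; `wmax = r + 2n` disables the weight clause of `bzLeaf`.
(definition) -/
def laneCheck (m0 s fuel : ℕ) : Bool :=
  familyOKv (c.rows.length + 2 * c.n) (List.range c.rows.length) c.allowWords c.letterRows
    (segment (c.d - 1) m0 s) 1 fuel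

/-- Structural checks: type-02's `checkStructure` and «every allow-listed word lives on the `n` qubits». (definition) -/
def checkStructureL : Bool :=
  c.checkStructure && c.allowList.all fun a => decide (a.1 < 2 ^ c.n) && decide (a.2 < 2 ^ c.n)

end AddCert

/-! ## The syndrome word and the encoding: bit semantics -/

/-- `sympParity` is a bit. -/
theorem sympParity_lt_two (n : ℕ) (r w : ℕ × ℕ) : sympParity n r w < 2 := by
  unfold sympParity; exact Nat.mod_lt _ (by norm_num)

/-- Bit `q` of the syndrome word is the parity against `rows[q]` (and `0` beyond the rows). -/
theorem testBit_synWord (n : ℕ) (w : ℕ × ℕ) :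
    ∀ (rows : List (ℕ × ℕ)) (q : ℕ),
      (synWord n rows w).testBit q = decide (q < rows.length ∧ sympParity n (rows.getD q (0, 0)) w = 1)
  | [], q => by simp [synWord]
  | r :: rs, 0 => by
    rw [synWord, Nat.testBit_lor, Nat.testBit_shiftLeft, Nat.testBit_zero]
    have := sympParity_lt_two n r w
    simp only [List.length_cons, Nat.zero_lt_succ, List.getD_cons_zero, true_and, ge_iff_le,
      Nat.le_zero, one_ne_zero, decide_false, Bool.false_and, Bool.or_false]
    congr 1
    simp only [eq_iff_iff]
    omega
  | r :: rs, q + 1 => by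
    rw [synWord, Nat.testBit_lor, Nat.testBit_shiftLeft, Nat.add_sub_cancel, testBit_synWord n w rs q]
    have h2 : (sympParity n r w).testBit (q + 1) = false :=
      Nat.testBit_lt_two_pow (lt_of_lt_of_le (sympParity_lt_two n r w) (by
        calc (2:ℕ) = 2 ^ 1 := by norm_num
          _ ≤ 2 ^ (q + 1) := Nat.pow_le_pow_right (by norm_num) (by omega)))
    rw [h2]
    simp only [List.length_cons, List.getD_cons_succ, Bool.false_or, ge_iff_le, Nat.le_add_left, decide_true,
      Bool.true_and]
    by_cases h : q < rs.length <;> simp [h]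

/-- The syndrome word has `|rows|` bits. -/
theorem synWord_lt (n : ℕ) (rows : List (ℕ × ℕ)) (w : ℕ × ℕ) : synWord n rows w < 2 ^ rows.length := by
  apply Nat.lt_pow_two_of_testBit
  intro i hi
  rw [testBit_synWord]
  simp [Nat.not_lt.2 hi]

namespace AddCert

variable (c : AddCert)

/-- **Bit layout of `enc`** (for an `x`-mask below `2^n`): syndrome bits, then `x`, then `z`. -/
theorem testBit_enc (w : ℕ × ℕ) (hw : w.1 < 2 ^ c.n) (q : ℕ) :
    (c.enc w).testBit q =
      if q < c.rows.length then decide (sympParity c.n (c.rows.getD q (0, 0)) w = 1)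
      else if q < c.rows.length + c.n then w.1.testBit (q - c.rows.length)
      else w.2.testBit (q - c.rows.length - c.n) := by
  rw [enc, Nat.testBit_lor, Nat.testBit_lor, Nat.testBit_shiftLeft, Nat.testBit_shiftLeft, testBit_synWord]
  by_cases h1 : q < c.rows.length
  · have : ¬ (q ≥ c.rows.length) := by omega
    have h' : ¬ (q ≥ c.rows.length + c.n) := by omega
    simp [h1, this, h']
  · by_cases h2 : q < c.rows.length + c.n
    · have h3 : q ≥ c.rows.length := by omega
      have h4 : ¬ (q ≥ c.rows.length + c.n) := by omega
      simp [h1, h2, h3, h4]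
    · have h3 : q ≥ c.rows.length := by omega
      have h4 : q ≥ c.rows.length + c.n := by omega
      have h5 : w.1.testBit (q - c.rows.length) = false :=
        Nat.testBit_lt_two_pow (lt_of_lt_of_le hw (Nat.pow_le_pow_right (by norm_num) (by omega)))
      have h6 : q - (c.rows.length + c.n) = q - c.rows.length - c.n := by omega
      simp [h1, h2, h3, h4, h5, h6]

/-- An encoded word with both masks below `2^n` has `r + 2n` bits. -/
theorem enc_lt (w : ℕ × ℕ) (hw1 : w.1 < 2 ^ c.n) (hw2 : w.2 < 2 ^ c.n) :
    c.enc w < 2 ^ (c.rows.length + 2 * c.n) := by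
  apply Nat.lt_pow_two_of_testBit
  intro i hi
  rw [c.testBit_enc w hw1]
  have h1 : ¬ i < c.rows.length := by omega
  have h2 : ¬ i < c.rows.length + c.n := by omega
  rw [if_neg h1, if_neg h2]
  exact Nat.testBit_lt_two_pow (lt_of_lt_of_le hw2 (Nat.pow_le_pow_right (by norm_num) (by omega)))

/-- The symplectic parity is additive in the Pauli word (bilinearity of the symplectic form). -/
theorem sympParity_xor (n : ℕ) (r a b : ℕ × ℕ) :
    sympParity n r (a.1 ^^^ b.1, a.2 ^^^ b.2) = (sympParity n r a + sympParity n r b) % 2 := by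
  have h := sympInner_ofBitPair_eq_sympParity (n := n) r (a.1 ^^^ b.1, a.2 ^^^ b.2)
  rw [show ((a.1 ^^^ b.1, a.2 ^^^ b.2) : ℕ × ℕ).1 = a.1 ^^^ b.1 from rfl,
    show ((a.1 ^^^ b.1, a.2 ^^^ b.2) : ℕ × ℕ).2 = a.2 ^^^ b.2 from rfl, ofBitPair_xor, sympInner_comm,
    sympInner_add_left, sympInner_comm (ofBitPair n a.1 a.2), sympInner_comm (ofBitPair n b.1 b.2),
    sympInner_ofBitPair_eq_sympParity, sympInner_ofBitPair_eq_sympParity, ← Nat.cast_add,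
    ZMod.natCast_eq_natCast_iff'] at h
  have hl := sympParity_lt_two n r (a.1 ^^^ b.1, a.2 ^^^ b.2)
  omega

/-- **`enc` is additive** on words whose `x`-masks are below `2^n`. -/
theorem enc_xor (a b : ℕ × ℕ) (ha : a.1 < 2 ^ c.n) (hb : b.1 < 2 ^ c.n) :
    c.enc (a.1 ^^^ b.1, a.2 ^^^ b.2) = c.enc a ^^^ c.enc b := by
  apply Nat.eq_of_testBit_eq
  intro q
  have hab : (a.1 ^^^ b.1) < 2 ^ c.n := Nat.xor_lt_two_pow ha hb
  rw [Nat.testBit_xor, c.testBit_enc _ hab, c.testBit_enc a ha, c.testBit_enc b hb]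
  by_cases h1 : q < c.rows.length
  · rw [if_pos h1, if_pos h1, if_pos h1, sympParity_xor]
    have h2 := sympParity_lt_two c.n (c.rows.getD q (0, 0)) a
    have h3 := sympParity_lt_two c.n (c.rows.getD q (0, 0)) b
    generalize sympParity c.n (c.rows.getD q (0, 0)) a = pa at *
    generalize sympParity c.n (c.rows.getD q (0, 0)) b = pb at *
    interval_cases pa <;> interval_cases pb <;> decide
  · simp only [if_neg h1]
    by_cases h2 : q < c.rows.length + c.n
    · simp only [if_pos h2]; exact Nat.testBit_xor _ _ _
    · simp only [if_neg h2]; exact Nat.testBit_xor _ _ _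

/-- The identity encodes to `0`. -/
theorem enc_zero : c.enc (0, 0) = 0 := by
  apply Nat.eq_of_testBit_eq
  intro q
  rw [c.testBit_enc (0, 0) (Nat.two_pow_pos _), Nat.zero_testBit]
  by_cases h1 : q < c.rows.length
  · have : sympParity c.n (c.rows.getD q (0, 0)) (0, 0) = 0 := by simp [sympParity, bitCount_eq_sum]
    rw [if_pos h1, this]
    simp
  · rw [if_neg h1]
    by_cases h2 : q < c.rows.length + c.n <;> simp [h2]

/-- **`enc` is injective on words living on the `n` qubits.** -/
theorem enc_inj {a b : ℕ × ℕ} (ha1 : a.1 < 2 ^ c.n) (ha2 : a.2 < 2 ^ c.n) (hb1 : b.1 < 2 ^ c.n)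
    (hb2 : b.2 < 2 ^ c.n) (h : c.enc a = c.enc b) : a = b := by
  have key : ∀ q, (c.enc a).testBit q = (c.enc b).testBit q := fun q => by rw [h]
  ext
  · apply Nat.eq_of_testBit_eq
    intro j
    by_cases hj : j < c.n
    · have := key (c.rows.length + j)
      rw [c.testBit_enc a ha1, c.testBit_enc b hb1] at this
      have h1 : ¬ c.rows.length + j < c.rows.length := by omega
      have h2 : c.rows.length + j < c.rows.length + c.n := by omega
      simpa [h1, h2] using this
    · rw [Nat.testBit_lt_two_pow (lt_of_lt_of_le ha1 (Nat.pow_le_pow_right (by norm_num) (by omega))),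
        Nat.testBit_lt_two_pow (lt_of_lt_of_le hb1 (Nat.pow_le_pow_right (by norm_num) (by omega)))]
  · apply Nat.eq_of_testBit_eq
    intro j
    by_cases hj : j < c.n
    · have := key (c.rows.length + c.n + j)
      rw [c.testBit_enc a ha1, c.testBit_enc b hb1] at this
      have h1 : ¬ c.rows.length + c.n + j < c.rows.length := by omega
      have h2 : ¬ c.rows.length + c.n + j < c.rows.length + c.n := by omega
      have h3 : c.rows.length + c.n + j - c.rows.length - c.n = j := by omega
      simpa [h1, h2, h3] using this
    · rw [Nat.testBit_lt_two_pow (lt_of_lt_of_le ha2 (Nat.pow_le_pow_right (by norm_num) (by omega))),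
        Nat.testBit_lt_two_pow (lt_of_lt_of_le hb2 (Nat.pow_le_pow_right (by norm_num) (by omega)))]

/-! ## The letter rows -/

/-- Length of the letter-row list. -/
theorem length_letterRowsFrom : ∀ (j m : ℕ), (c.letterRowsFrom j m).length = 3 * m
  | _, 0 => rfl
  | j, m + 1 => by
    rw [letterRowsFrom, List.length_cons, List.length_cons, List.length_cons, length_letterRowsFrom (j + 1) m]
    omega

/-- There are `3n` letter rows. -/
theorem length_letterRows : c.letterRows.length = 3 * c.n := c.length_letterRowsFrom 0 c.n

/-- The letter word at index `3(j₀+i) − 3j₀ + ℓ` of `letterRowsFrom j₀ m`. -/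
theorem getD_letterRowsFrom (bx bz : Bool) (hl : (bx || bz) = true) :
    ∀ (j m i : ℕ), i < m →
      (c.letterRowsFrom j m).getD (3 * i + (if bz then (if bx then 2 else 1) else 0)) 0 =
        c.enc (if bx then 2 ^ (j + i) else 0, if bz then 2 ^ (j + i) else 0)
  | _, 0, i, hi => absurd hi (Nat.not_lt_zero _)
  | j, m + 1, 0, _ => by
    rw [letterRowsFrom]
    cases bx <;> cases bz <;> simp_all
  | j, m + 1, i + 1, hi => by
    rw [letterRowsFrom]
    have h := getD_letterRowsFrom bx bz hl (j + 1) m i (by omega)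
    have e : 3 * (i + 1) + (if bz then (if bx then 2 else 1) else 0) =
        (3 * i + (if bz then (if bx then 2 else 1) else 0)) + 3 := by omega
    rw [e, List.getD_cons_succ, List.getD_cons_succ, List.getD_cons_succ, h,
      show j + 1 + i = j + (i + 1) by omega]

/-- The row index of a lettered selection entry `(j, bx, bz)`: `3j` for `X`, `3j+1` for `Z`, `3j+2` for `Y`.
(used only in proofs) -/
def lidx (e : ℕ × Bool × Bool) : ℕ := 3 * e.1 + (if e.2.2 then (if e.2.1 then 2 else 1) else 0)

/-- `lidx e / 3` is the qubit. -/
theorem lidx_div (e : ℕ × Bool × Bool) : lidx e / 3 = e.1 := by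
  unfold lidx; split_ifs <;> omega

/-- Bounds of `lidx`. -/
theorem lidx_bounds (e : ℕ × Bool × Bool) : 3 * e.1 ≤ lidx e ∧ lidx e ≤ 3 * e.1 + 2 := by
  unfold lidx; split_ifs <;> omega

/-- The letter row of a non-identity entry is the encoding of its one-qubit word. -/
theorem getD_letterRows_lidx (e : ℕ × Bool × Bool) (he : e.1 < c.n) (hl : (e.2.1 || e.2.2) = true) :
    c.letterRows.getD (lidx e) 0 = c.enc (if e.2.1 then 2 ^ e.1 else 0, if e.2.2 then 2 ^ e.1 else 0) := by
  have := c.getD_letterRowsFrom e.2.1 e.2.2 hl 0 c.n e.1 he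
  simpa [letterRows, lidx] using this

/-- The accumulated `x`-word of a selection on qubits `< n` is below `2^n`. -/
theorem accX_lt (n : ℕ) : ∀ (S : Sel), (∀ e ∈ S, e.1 < n) → accX S < 2 ^ n
  | [], _ => Nat.two_pow_pos n
  | (j, bx, bz) :: T, h => by
    rw [accX]
    refine Nat.xor_lt_two_pow ?_ (accX_lt n T fun e he => h e (List.mem_cons_of_mem _ he))
    have hj : j < n := h (j, bx, bz) (by simp)
    split_ifs
    · exact Nat.pow_lt_pow_right (by norm_num) hj
    · exact Nat.two_pow_pos n

/-- The accumulated `z`-word of a selection on qubits `< n` is below `2^n`. -/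
theorem accZ_lt (n : ℕ) : ∀ (S : Sel), (∀ e ∈ S, e.1 < n) → accZ S < 2 ^ n
  | [], _ => Nat.two_pow_pos n
  | (j, bx, bz) :: T, h => by
    rw [accZ]
    refine Nat.xor_lt_two_pow ?_ (accZ_lt n T fun e he => h e (List.mem_cons_of_mem _ he))
    have hj : j < n := h (j, bx, bz) (by simp)
    split_ifs
    · exact Nat.pow_lt_pow_right (by norm_num) hj
    · exact Nat.two_pow_pos n

/-- **The letter rows of a non-identity lettered selection XOR to the encoding of its word.** -/
theorem xorList_letterRows : ∀ (S : Sel), (∀ e ∈ S, e.1 < c.n) → (∀ e ∈ S, (e.2.1 || e.2.2) = true) →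
    xorList (S.map fun e => c.letterRows.getD (lidx e) 0) = c.enc (accX S, accZ S)
  | [], _, _ => by rw [List.map_nil, xorList, accX, accZ, c.enc_zero]
  | (j, bx, bz) :: T, hlt, hnz => by
    rw [List.map_cons, xorList, accX, accZ,
      xorList_letterRows T (fun e he => hlt e (List.mem_cons_of_mem _ he))
        (fun e he => hnz e (List.mem_cons_of_mem _ he)),
      c.getD_letterRows_lidx (j, bx, bz) (hlt _ (by simp)) (hnz _ (by simp))]
    symm
    refine c.enc_xor ((if bx then 2 ^ j else 0), (if bz then 2 ^ j else 0)) (accX T, accZ T) ?_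
      (accX_lt c.n T fun e he => hlt e (List.mem_cons_of_mem _ he))
    have hj : j < c.n := hlt (j, bx, bz) (by simp)
    show (if bx then 2 ^ j else 0) < 2 ^ c.n
    split_ifs
    · exact Nat.pow_lt_pow_right (by norm_num) hj
    · exact Nat.two_pow_pos _

end AddCert

end Summit.Ventures.QEC.Census
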